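import Mathlib.Topology.Algebra.Ring.Basic
import Mathlib.Topology.Algebra.ContinuousMonoidHom
import Mathlib.Algebra.BigOperators.Fin
import Mathlib.Data.Fin.Tuple.Basic
import HarnessLib

/-!
# Pseudocharacters (Taylor's pseudo-representations) and continuous pseudocharacters

Let `G` be a monoid (Taylor: a group) and `A` a commutative ring.  For a map `T : G → A` and
`n ≥ 0`, the **Frobenius functional** `S_n(T) : Gⁿ → A` of Frobenius–Taylor–Rouquier is
`S_n(T)(x) = ∑_{σ ∈ 𝔖_n} ε(σ) T^σ(x)`, where for a cycle `c = (j₁ … j_m)` one puts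
`T^c(x) = T(x_{j₁} ⋯ x_{j_m})` and `T^σ = ∏ T^{c_i}` over the cycle decomposition `σ = c₁ ⋯ c_s`
(cycles of length one included) [cite: Taylor1991, §1], [cite: Rouquier1996, §2 p. 572],
[cite: Chenevier2014, Introduction (7.1)], [cite: BellaicheChenevier2009, §1.2.1].
We *define* `S_n(T)` (`frobeniusS T n`) by Rouquier's recursion
`S_0(T) = 1`, `S_{n+1}(T)(x₁,…,x_{n+1}) = T(x_{n+1}) S_n(T)(x₁,…,x_n) - ∑_{i=1}^{n} S_n(T)(x₁,…,x_{i-1}, x_i x_{n+1}, x_{i+1},…,x_n)`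
[cite: Rouquier1996, Lemme 2.2(1)] (also the definition taken in [cite: Ophir2024, §1 (1.1)-(1.2) and Remark 1.2]),
which for a central `T` is Rouquier's Lemma 2.2(1) and hence agrees with the signed cycle sum;
the values `S_1, S_2, S_3` are checked against the printed formulas in `frobeniusS_one`,
`frobeniusS_two`, `frobeniusS_three` (Hida's display of (T3) for `n = 2`,
[cite: Hida2000, §2.2.2 p. 89]).

A **pseudocharacter of dimension `d`** (Taylor's *pseudo-representation*, [cite: Taylor1991, §1];
as reported in [cite: Rouquier1996, §2 p. 573] and [cite: Hida2000, §2.2.2 (T1)–(T3)]) is a map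
`T : G → A` with `T(1) = d`, `T(gh) = T(hg)` and `S_{d+1}(T) ≡ 0` (`IsPseudocharacter T d`).
Bellaïche–Chenevier and Chenevier add the requirement that `d!` be invertible in `A`
([cite: BellaicheChenevier2009, §1.2.1], [cite: Chenevier2014, Introduction]); we follow Taylor and
do not (it is automatic over `ℚ`-algebras, the case of Taylor's theorem).
A **continuous pseudocharacter** of a topological monoid with values in a topological ring is a
continuous such `T` (`ContinuousPseudocharacter G A d`), the notion used for `p`-adic limits and
families of Galois representations ([cite: BellaicheChenevier2009, §1.2.1], [cite: Chenevier2014, §2.5]).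

## Main definitions and results (all proved)

* `frobeniusS T n x`, `frobeniusS_one/two/three`, `frobeniusS_comp` (functorial in `G`),
  `frobeniusS_map` (functorial in `A`), `continuous_frobeniusS_apply`.
* `IsPseudocharacter T d` with `.comp`, `.map`, `.of_tendsto`, `isClosed_setOf_isPseudocharacter`
  (the pseudocharacters of dimension `d` form a closed subset of `G → A`: limits of pseudocharacters
  are pseudocharacters), `MonoidHom`s are exactly the pseudocharacters of dimension `1`
  (`isPseudocharacter_one_iff`).
* `ContinuousPseudocharacter G A d` (a `FunLike`), `comp`, `map`, `ofContinuousMonoidHom`,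
  `ofTendsto` (a continuous pointwise limit of continuous pseudocharacters is one), `ker` (Taylor's
  kernel `{h | ∀ g, T(gh) = T(g)}`, a closed normal subgroup).
* The main example — the trace of a (framed, continuous) representation of rank `d` is a
  (continuous) pseudocharacter of dimension `d` (Frobenius) — is proved in
  `Literature/NumberTheory/GaloisRepresentations/PseudocharacterTrace.lean`; Taylor's converse
  theorem is vendored as a named fact in `…/PseudocharacterTaylor.lean`.

Mathlib has no pseudocharacters / pseudorepresentations / determinant laws (searched
`seudochar|seudorep`, 2026-08-15).
-/

namespace Literature.NumberTheory.GaloisRepresentations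

open _root_.Topology Filter

universe u v w

/-! ### The Frobenius functional `S_n(T)` -/

section Frobenius

variable {G : Type u} [Monoid G] {A : Type v} [CommRing A]

/-- The **Frobenius functional** `S_n(T) : Gⁿ → A` attached to `T : G → A`, defined by Rouquier's
recursion `S_0(T) = 1`,
`S_{n+1}(T)(x) = T(x_{n+1})·S_n(T)(x₁,…,x_n) - ∑_{i ≤ n} S_n(T)(x₁,…,x_i x_{n+1},…,x_n)`
[cite: Rouquier1996, Lemme 2.2(1)], [cite: Ophir2024, §1 (1.2)]; for central `T` it equals Taylor's
`∑_{σ ∈ 𝔖_n} ε(σ) T^σ(x)` [cite: Taylor1991, §1], [cite: Chenevier2014, Introduction (7.1)]. -/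
def frobeniusS (T : G → A) : (n : ℕ) → (Fin n → G) → A
  | 0, _ => 1
  | n + 1, x => T (x (Fin.last n)) * frobeniusS T n (Fin.init x) -
      ∑ i : Fin n, frobeniusS T n (Function.update (Fin.init x) i (x (Fin.castSucc i) * x (Fin.last n)))

/-- `S_0(T) = 1`. [cite: Rouquier1996, §2 p. 573] -/
@[simp] lemma frobeniusS_zero (T : G → A) (x : Fin 0 → G) : frobeniusS T 0 x = 1 := rfl

/-- Rouquier's recursion for `S_{n+1}(T)` (here the definition). [cite: Rouquier1996, Lemme 2.2(1)] -/
lemma frobeniusS_succ (T : G → A) (n : ℕ) (x : Fin (n + 1) → G) :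
    frobeniusS T (n + 1) x = T (x (Fin.last n)) * frobeniusS T n (Fin.init x) -
      ∑ i : Fin n, frobeniusS T n
        (Function.update (Fin.init x) i (x (Fin.castSucc i) * x (Fin.last n))) := rfl

/-- `S_1(T)(x) = T(x)`. [cite: Ophir2024, §1 footnote 1] -/
@[simp] lemma frobeniusS_one (T : G → A) (x : Fin 1 → G) : frobeniusS T 1 x = T (x 0) := by
  simp [frobeniusS_succ]

/-- `S_2(T)(x₀,x₁) = T(x₀)T(x₁) - T(x₀x₁)`. [cite: Ophir2024, §1 footnote 1] -/
lemma frobeniusS_two (T : G → A) (x : Fin 2 → G) :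
    frobeniusS T 2 x = T (x 0) * T (x 1) - T (x 0 * x 1) := by
  simp [frobeniusS_succ, Fin.init, mul_comm]

/-- `S_3(T)(x₀,x₁,x₂) = T(x₀)T(x₁)T(x₂) - T(x₀x₁)T(x₂) - T(x₀x₂)T(x₁) - T(x₁x₂)T(x₀) + T(x₀x₁x₂) + T(x₀x₂x₁)`,
Taylor's identity (T3) for `n = 2`. [cite: Hida2000, §2.2.2 p. 89], [cite: Ophir2024, §1 footnote 1] -/
lemma frobeniusS_three (T : G → A) (x : Fin 3 → G) :
    frobeniusS T 3 x = T (x 0) * T (x 1) * T (x 2) - T (x 0 * x 1) * T (x 2)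
      - T (x 0 * x 2) * T (x 1) - T (x 1 * x 2) * T (x 0) + T (x 0 * x 1 * x 2)
      + T (x 0 * x 2 * x 1) := by
  simp only [frobeniusS_succ, frobeniusS_zero, Fin.sum_univ_succ, Fin.sum_univ_zero, Fin.init,
    Function.update]
  simp [mul_assoc]
  ring

/-- `S_n` is natural in `G`: `S_n(T ∘ φ)(x) = S_n(T)(φ ∘ x)` for a multiplicative `φ`. [folklore] -/
lemma frobeniusS_comp {H : Type w} [Monoid H] {F : Type*} [FunLike F H G] [MonoidHomClass F H G]
    (T : G → A) (φ : F) (n : ℕ) (x : Fin n → H) :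
    frobeniusS (T ∘ φ) n x = frobeniusS T n (φ ∘ x) := by
  induction n with
  | zero => rfl
  | succ n ih =>
    simp only [frobeniusS_succ, Function.comp_apply, ih, Function.comp_update, map_mul]
    rfl

/-- `S_n` is natural in `A`: `S_n(f ∘ T) = f ∘ S_n(T)` for a ring homomorphism `f`. [folklore] -/
lemma frobeniusS_map {B : Type w} [CommRing B] (T : G → A) (f : A →+* B) (n : ℕ) (x : Fin n → G) :
    frobeniusS (f ∘ T) n x = f (frobeniusS T n x) := by
  induction n with
  | zero => simp
  | succ n ih => simp [frobeniusS_succ, ih]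

/-- `T ↦ S_n(T)(x)` is continuous for the product topology on `G → A` (it is a polynomial in
finitely many values of `T`). [folklore] -/
lemma continuous_frobeniusS_apply [TopologicalSpace A] [IsTopologicalRing A] (n : ℕ) (x : Fin n → G) :
    Continuous fun T : G → A => frobeniusS T n x := by
  induction n with
  | zero => exact continuous_const
  | succ n ih =>
    simp only [frobeniusS_succ]
    exact ((continuous_apply _).mul (ih _)).sub (continuous_finsetSum _ fun i _ => ih _)

end Frobenius

/-! ### Pseudocharacters of dimension `d` -/

section IsPseudocharacter

variable {G : Type u} [Monoid G] {A : Type v} [CommRing A]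

/-- `T : G → A` is a **pseudocharacter of dimension `d`** (Taylor's *pseudo-representation of
dimension `d`*): `T(1) = d`, `T(gh) = T(hg)` for all `g, h`, and the Frobenius identity
`S_{d+1}(T)(x) = 0` for all `x ∈ G^{d+1}`.
[cite: Taylor1991, §1], [cite: Rouquier1996, §2 p. 573], [cite: Hida2000, §2.2.2 (T1)–(T3)] -/
structure IsPseudocharacter (T : G → A) (d : ℕ) : Prop where
  /-- (T1) `T(1) = d`. -/
  map_one : T 1 = d
  /-- (T2) `T` is central: `T(gh) = T(hg)`. -/
  map_mul_comm : ∀ g h : G, T (g * h) = T (h * g)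
  /-- (T3) the `d`-dimensional pseudocharacter identity `S_{d+1}(T) ≡ 0`. -/
  frobenius : ∀ x : Fin (d + 1) → G, frobeniusS T (d + 1) x = 0

/-- `IsPseudocharacter` as a conjunction. [folklore] -/
lemma isPseudocharacter_iff (T : G → A) (d : ℕ) :
    IsPseudocharacter T d ↔ T 1 = d ∧ (∀ g h : G, T (g * h) = T (h * g)) ∧
      ∀ x : Fin (d + 1) → G, frobeniusS T (d + 1) x = 0 :=
  ⟨fun h => ⟨h.1, h.2, h.3⟩, fun h => ⟨h.1, h.2.1, h.2.2⟩⟩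

namespace IsPseudocharacter

variable {T : G → A} {d : ℕ}

/-- Pull-back of a pseudocharacter along a multiplicative map `φ : H → G`
(restriction to a subgroup, inflation). [cite: BellaicheChenevier2009, §1.2.1] -/
lemma comp {H : Type w} [Monoid H] {F : Type*} [FunLike F H G] [MonoidHomClass F H G]
    (hT : IsPseudocharacter T d) (φ : F) : IsPseudocharacter (T ∘ φ) d where
  map_one := by simp [hT.map_one]
  map_mul_comm g h := by simp [map_mul, hT.map_mul_comm]
  frobenius x := by rw [frobeniusS_comp, hT.frobenius]

/-- Extension of scalars of a pseudocharacter along a ring homomorphism `f : A → B`.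
[cite: BellaicheChenevier2009, §1.2.1] -/
lemma map {B : Type w} [CommRing B] (hT : IsPseudocharacter T d) (f : A →+* B) :
    IsPseudocharacter (f ∘ T) d where
  map_one := by simp [hT.map_one]
  map_mul_comm g h := by simp [hT.map_mul_comm g h]
  frobenius x := by rw [frobeniusS_map, hT.frobenius, map_zero]

/-- A pseudocharacter of dimension `1` is multiplicative (`S_2(T) = 0` reads `T(gh) = T(g)T(h)`).
[cite: Rouquier1996, §2 p. 573] -/
lemma map_mul_of_dim_one (hT : IsPseudocharacter T 1) (g h : G) : T (g * h) = T g * T h := by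
  have := hT.frobenius ![g, h]
  rw [frobeniusS_two] at this
  simpa [sub_eq_zero, eq_comm] using this

end IsPseudocharacter

/-- A multiplicative map `χ : G → A` (a character) is a pseudocharacter of dimension `1`.
[cite: Rouquier1996, §2 p. 573] -/
lemma isPseudocharacter_one_of_monoidHomClass {F : Type*} [FunLike F G A] [MonoidHomClass F G A]
    (χ : F) : IsPseudocharacter (χ : G → A) 1 where
  map_one := by simp
  map_mul_comm g h := by rw [map_mul, map_mul, mul_comm]
  frobenius x := by rw [frobeniusS_two, map_mul, sub_self]

/-- The pseudocharacters of dimension `1` are exactly the monoid homomorphisms `G → A`.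
[cite: Rouquier1996, §2 p. 573] -/
lemma isPseudocharacter_one_iff (T : G → A) :
    IsPseudocharacter T 1 ↔ T 1 = 1 ∧ ∀ g h : G, T (g * h) = T g * T h := by
  constructor
  · exact fun hT => ⟨by simpa using hT.map_one, hT.map_mul_of_dim_one⟩
  · rintro ⟨h1, hmul⟩
    exact isPseudocharacter_one_of_monoidHomClass (MonoidHom.mk ⟨T, h1⟩ hmul)

/-- **Limits of pseudocharacters are pseudocharacters**: in the topology of pointwise convergence
on `G → A` (`A` a Hausdorff topological ring) the pseudocharacters of dimension `d` form a closed
subset, each defining identity being polynomial in finitely many values.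
[cite: Chenevier2014, §2.5 Example 7.51], [cite: BellaicheChenevier2009, §1.2.1] -/
theorem isClosed_setOf_isPseudocharacter [TopologicalSpace A] [IsTopologicalRing A] [T2Space A]
    (d : ℕ) : IsClosed {T : G → A | IsPseudocharacter T d} := by
  have h : {T : G → A | IsPseudocharacter T d} = {T : G → A | T 1 = (d : A)} ∩
      ((⋂ g : G, ⋂ h : G, {T : G → A | T (g * h) = T (h * g)}) ∩
        ⋂ x : Fin (d + 1) → G, {T : G → A | frobeniusS T (d + 1) x = 0}) := by
    ext T
    simp only [Set.mem_setOf_eq, Set.mem_inter_iff, Set.mem_iInter]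
    exact isPseudocharacter_iff T d
  rw [h]
  exact (isClosed_eq (continuous_apply 1) continuous_const).inter
    ((isClosed_iInter fun g => isClosed_iInter fun h =>
      isClosed_eq (continuous_apply (g * h)) (continuous_apply (h * g))).inter
      (isClosed_iInter fun x => isClosed_eq (continuous_frobeniusS_apply (d + 1) x) continuous_const))

/-- A pointwise limit (along a non-trivial filter) of pseudocharacters of dimension `d` is a
pseudocharacter of dimension `d`. [cite: Chenevier2014, §2.5 Example 7.51] -/
theorem IsPseudocharacter.of_tendsto [TopologicalSpace A] [IsTopologicalRing A] [T2Space A]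
    {ι : Type*} {l : Filter ι} [l.NeBot] {T : ι → G → A} {T₀ : G → A} {d : ℕ}
    (hT : ∀ᶠ i in l, IsPseudocharacter (T i) d) (hlim : Tendsto T l (𝓝 T₀)) :
    IsPseudocharacter T₀ d :=
  (isClosed_setOf_isPseudocharacter d).mem_of_tendsto hlim hT

end IsPseudocharacter

/-! ### Continuous pseudocharacters -/

/-- A **continuous pseudocharacter of dimension `d`** of the topological monoid `G` with values
in the topological commutative ring `A`: a continuous map `T : G → A` which is a pseudocharacter
of dimension `d` (`T(1) = d`, `T(gh) = T(hg)`, `S_{d+1}(T) ≡ 0`).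
[cite: Taylor1991, §1], [cite: BellaicheChenevier2009, §1.2.1], [cite: Chenevier2014, §2.5] -/
structure ContinuousPseudocharacter (G : Type u) (A : Type v) [Monoid G] [TopologicalSpace G]
    [CommRing A] [TopologicalSpace A] (d : ℕ) where
  /-- The underlying function `G → A`. -/
  toFun : G → A
  /-- The underlying function is a pseudocharacter of dimension `d`. -/
  isPseudocharacter_toFun : IsPseudocharacter toFun d
  /-- The underlying function is continuous. -/
  continuous_toFun : Continuous toFun

namespace ContinuousPseudocharacter

section Monoid

variable {G : Type u} {A : Type v} [Monoid G] [TopologicalSpace G] [CommRing A] [TopologicalSpace A]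
  {d : ℕ}

/-- A continuous pseudocharacter is a function `G → A`. [folklore] -/
instance instFunLike : FunLike (ContinuousPseudocharacter G A d) G A where
  coe := toFun
  coe_injective T T' h := by cases T; cases T'; congr

/-- Two continuous pseudocharacters are equal if they agree pointwise. [folklore] -/
@[ext] theorem ext {T T' : ContinuousPseudocharacter G A d} (h : ∀ g, T g = T' g) : T = T' :=
  DFunLike.ext _ _ h

/-- Unfolding lemma for the coercion. [folklore] -/
@[simp] lemma toFun_eq_coe (T : ContinuousPseudocharacter G A d) : T.toFun = ⇑T := rfl

/-- Unfolding lemma for the anonymous constructor. [folklore] -/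
@[simp] lemma coe_mk (T : G → A) (h₁ : IsPseudocharacter T d) (h₂ : Continuous T) :
    ⇑(⟨T, h₁, h₂⟩ : ContinuousPseudocharacter G A d) = T := rfl

/-- A continuous pseudocharacter is continuous. [folklore] -/
@[continuity, fun_prop]
protected lemma continuous (T : ContinuousPseudocharacter G A d) : Continuous T := T.continuous_toFun

/-- A continuous pseudocharacter is a pseudocharacter. [folklore] -/
lemma isPseudocharacter (T : ContinuousPseudocharacter G A d) : IsPseudocharacter T d :=
  T.isPseudocharacter_toFun

/-- (T1) `T(1) = d`. [cite: Taylor1991, §1] -/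
@[simp] lemma map_one (T : ContinuousPseudocharacter G A d) : T 1 = d := T.isPseudocharacter.map_one

/-- (T2) `T(gh) = T(hg)`. [cite: Taylor1991, §1] -/
lemma map_mul_comm (T : ContinuousPseudocharacter G A d) (g h : G) : T (g * h) = T (h * g) :=
  T.isPseudocharacter.map_mul_comm g h

/-- (T3) `S_{d+1}(T) ≡ 0`. [cite: Taylor1991, §1] -/
lemma frobenius (T : ContinuousPseudocharacter G A d) (x : Fin (d + 1) → G) :
    frobeniusS T (d + 1) x = 0 :=
  T.isPseudocharacter.frobenius x

/-- A continuous character `χ : G →ₜ* A` is a continuous pseudocharacter of dimension `1`.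
[cite: Rouquier1996, §2 p. 573] -/
def ofContinuousMonoidHom (χ : G →ₜ* A) : ContinuousPseudocharacter G A 1 where
  toFun := χ
  isPseudocharacter_toFun := isPseudocharacter_one_of_monoidHomClass χ
  continuous_toFun := χ.continuous_toFun

/-- Unfolding lemma for `ofContinuousMonoidHom`. [folklore] -/
@[simp] lemma ofContinuousMonoidHom_apply (χ : G →ₜ* A) (g : G) : ofContinuousMonoidHom χ g = χ g :=
  rfl

/-- Pull-back `T ∘ φ` of a continuous pseudocharacter along a continuous homomorphism
`φ : H →ₜ* G` (restriction, inflation). [cite: BellaicheChenevier2009, §1.2.1] -/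
def comp {H : Type w} [Monoid H] [TopologicalSpace H] (T : ContinuousPseudocharacter G A d)
    (φ : H →ₜ* G) : ContinuousPseudocharacter H A d where
  toFun := T ∘ φ
  isPseudocharacter_toFun := T.isPseudocharacter.comp φ
  continuous_toFun := T.continuous.comp φ.continuous_toFun

/-- Unfolding lemma for `comp`. [folklore] -/
@[simp] lemma comp_apply {H : Type w} [Monoid H] [TopologicalSpace H]
    (T : ContinuousPseudocharacter G A d) (φ : H →ₜ* G) (h : H) : T.comp φ h = T (φ h) := rfl

/-- Extension of scalars `f ∘ T` along a continuous ring homomorphism `f : A → B`.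
[cite: BellaicheChenevier2009, §1.2.1] -/
def map {B : Type w} [CommRing B] [TopologicalSpace B] (T : ContinuousPseudocharacter G A d)
    (f : A →+* B) (hf : Continuous f) : ContinuousPseudocharacter G B d where
  toFun := f ∘ T
  isPseudocharacter_toFun := T.isPseudocharacter.map f
  continuous_toFun := hf.comp T.continuous

/-- Unfolding lemma for `map`. [folklore] -/
@[simp] lemma map_apply {B : Type w} [CommRing B] [TopologicalSpace B]
    (T : ContinuousPseudocharacter G A d) (f : A →+* B) (hf : Continuous f) (g : G) :
    T.map f hf g = f (T g) := rfl

/-- **Limits**: a continuous map `T₀ : G → A` which is a pointwise limit, along a non-trivial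
filter, of continuous pseudocharacters of dimension `d` (`A` Hausdorff) is a continuous
pseudocharacter of dimension `d`. [cite: Chenevier2014, §2.5 Example 7.51] -/
def ofTendsto [IsTopologicalRing A] [T2Space A] {ι : Type*} {l : Filter ι} [l.NeBot]
    (T : ι → ContinuousPseudocharacter G A d) (T₀ : G → A)
    (hlim : Tendsto (fun i => ⇑(T i)) l (𝓝 T₀)) (hT₀ : Continuous T₀) :
    ContinuousPseudocharacter G A d where
  toFun := T₀
  isPseudocharacter_toFun :=
    IsPseudocharacter.of_tendsto (Eventually.of_forall fun i => (T i).isPseudocharacter) hlim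
  continuous_toFun := hT₀

/-- Unfolding lemma for `ofTendsto`. [folklore] -/
@[simp] lemma ofTendsto_apply [IsTopologicalRing A] [T2Space A] {ι : Type*} {l : Filter ι}
    [l.NeBot] (T : ι → ContinuousPseudocharacter G A d) (T₀ : G → A)
    (hlim : Tendsto (fun i => ⇑(T i)) l (𝓝 T₀)) (hT₀ : Continuous T₀) (g : G) :
    ofTendsto T T₀ hlim hT₀ g = T₀ g := rfl

end Monoid

section Group

variable {G : Type u} {A : Type v} [Group G] [TopologicalSpace G] [CommRing A] [TopologicalSpace A]
  {d : ℕ}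

/-- **Taylor's kernel** of a pseudocharacter: `ker T = {h | ∀ g, T(gh) = T(g)}`, a normal
subgroup of `G`. [cite: Taylor1991, §1] -/
def ker (T : ContinuousPseudocharacter G A d) : Subgroup G where
  carrier := {h | ∀ g, T (g * h) = T g}
  one_mem' g := by rw [mul_one]
  mul_mem' {a b} ha hb g := by rw [← mul_assoc, hb, ha]
  inv_mem' {a} ha g := by rw [← ha (g * a⁻¹), inv_mul_cancel_right]

/-- Membership in Taylor's kernel. [cite: Taylor1991, §1] -/
@[simp] lemma mem_ker {T : ContinuousPseudocharacter G A d} {h : G} : h ∈ T.ker ↔ ∀ g, T (g * h) = T g :=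
  Iff.rfl

/-- Taylor's kernel is a normal subgroup (by centrality of `T`). [cite: Taylor1991, §1] -/
instance normal_ker (T : ContinuousPseudocharacter G A d) : T.ker.Normal where
  conj_mem h hh k g := by
    calc T (g * (k * h * k⁻¹)) = T ((g * k * h) * k⁻¹) := by simp only [mul_assoc]
      _ = T (k⁻¹ * (g * k * h)) := T.map_mul_comm _ _
      _ = T ((k⁻¹ * g * k) * h) := by simp only [mul_assoc]
      _ = T (k⁻¹ * g * k) := hh _
      _ = T (k⁻¹ * (g * k)) := by simp only [mul_assoc]
      _ = T ((g * k) * k⁻¹) := T.map_mul_comm _ _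
      _ = T g := by rw [mul_inv_cancel_right]

/-- Taylor's kernel is closed when `A` is Hausdorff. [folklore] -/
theorem isClosed_ker [ContinuousMul G] [T2Space A] (T : ContinuousPseudocharacter G A d) :
    IsClosed (T.ker : Set G) := by
  have : (T.ker : Set G) = ⋂ g : G, {h | T (g * h) = T g} := by
    ext h; simp
  rw [this]
  exact isClosed_iInter fun g =>
    isClosed_eq (T.continuous.comp (continuous_const.mul continuous_id)) continuous_const

end Group

end ContinuousPseudocharacter

end Literature.NumberTheory.GaloisRepresentations
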